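import Literature.MathematicalPhysics.QuantumFieldTheory.Balaban1983to89.B2Eq265From260

/-!
# `Balaban1983to89.B2Eq265BoxMargins` — [Balaban1982Higgs2] Lemma 2.4 (2.65) p.572 on the (Higgs)₂,₃ carrier of record with the
# positional hypotheses on `x` READ AS IN PRINT: «x ∈ Bᵏ(y), y ∈ Λ₇^{(k−1)′}» with (p.572, AS PRINTED, render re-read by the row owner r02
# 2026-08-23) «Let us define □₁, □₂ as the sums of large blocks contained in Λ₇^{(k−1)′} and distant from the point y less than 2r(Lᵏε),
# 4r(Lᵏε) respectively, and let us denote □ = Bᵏ(□₂). Of course □ ⊂ Bᵏ(Λ₂^{(k−1)′}).» — `ȳ = x_k` sits at least a coarse margin `m`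
# inside `□₂` («4r»), the cube `□₁` of radius `R₁ ≤ m` («2r ≤ 4r») about it is then INSIDE `□₂`, smaller than half the torus, and the
# fine point `x ∈ Bᵏ(ȳ)` is `Lᵏm`-deep in `□ = Bᵏ(□₂)`: F10's three geometric hypotheses `□₁ ⊆ □₂`, `2(2R₁+1) ≤ |T^{(k)}|_μ` and the
# depth of `x` are DERIVED (`eq265_higgs_region_margins`)

statement-level skeleton of published theorems with citation tags; proofs where landed; nothing here is a claim
about the Yang–Mills mass gap

PDF held: `paper:balaban1982-cmp86-higgs23-ii` (journal page = PDF page + 554), p. 572 [PDF 18] (Lemma 2.4 L1–4; the `□₁/□₂` sentence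
L6–8), p. 558 [PDF 4] ((2.7) «r(ε) ≧ R₀|log ε|^{3r₀}», the radii).

CITATION HEADER (lean-in-tree rule).  T. Bałaban, *(Higgs)₂,₃ quantum fields in a finite volume. II. An upper bound*,
Commun. Math. Phys. **86** (1982) 555–594, doi:10.1007/bf01214890 [Balaban1982Higgs2].  Cell `lit-balaban` (HOME
`run/shared/lean/pub/lit-balaban/`), Phase-2 proof seat **p23** gen 22 (unit `lit-balaban-p23-g22`; free-target protocol G.5-34(d), TAKING #3
line HOME/STATUS.md 2026-08-23); SKELETON row **B2.Lem2.4** (fold owner r02, second reader r14; head `proved p250408 · …` UNCHANGED —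
cells-only member, brick F11; item (ii) of the gen-21 successor list, HOME/HANDOFF.md § «lit-balaban-p23 gen 21»).  USED BY NAME, never
restated: own F10 `B2Eq265From260.eq265_higgs_region_from260`, own F7 `B2Eq265ConstantPart.{val_sub_toFinest_eq, mem_underRegion_iff_offsets}`
(`Bᵏ(q + [0,S)ᵈ) = q̄ + [0,LᵏS)ᵈ`), p15's `B2Ineq329ZeroAveraging.sitesPerDir_zero_eq` (`|T_ε|_ν = Lᵏ|T^{(k)}|_ν`), the typer's
`B2Eq255Concrete.underRegion`, `HiggsLattice.Site.tdist` ((1.3)), `HiggsAveraging.blockIter`.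

THE ARGUMENT.  Let `□₂ = q + [0,S)ᵈ ⊂ T^{(k)}` (`LᵏS < |T_ε|_ν`, `2LᵏS ≤ |T_ε|_ν`), `ȳ = x_k`, and suppose `m ≤ n_ν(ȳ − q)` and
`n_ν(ȳ − q) + m < S` for every `ν` (a coarse margin `m`).  (1) DEPTH: by F7's label identity `n_ν(x − q̄) = Lᵏn_ν(ȳ − q) + (n_ν(x) mod Lᵏ)`
the fine offsets of `x` from the corner `q̄` lie in `[Lᵏm, LᵏS − Lᵏm)`, so for a fine `z` with `|x − z| ≤ R ≤ Lᵏm` ((1.3): in each direction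
one of `n(x_ν − z_ν)`, `n(z_ν − x_ν)` is `≤ R`) the offset `n_ν(z − q̄)` is `n_ν(x − q̄) ∓ (≤ R) ∈ [0, LᵏS)` without wrap-around (`2LᵏS ≤ |T_ε|_ν`),
i.e. `z ∈ Bᵏ(□₂)` (`mem_underRegion_of_tdist_le`).  (2) INCLUSION: if `□₁ = q₁ + [0,2R₁+1)ᵈ` has centre `ȳ` (`n_ν(ȳ − q₁) = R₁`) and
`R₁ ≤ m`, then `n_ν(q₁ − q) = n_ν(ȳ − q) − R₁` and every `y ∈ □₁` has `n_ν(y − q) = n_ν(y − q₁) + n_ν(q₁ − q) < R₁ + 1 + n_ν(ȳ − q) ≤ S`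
(`S < |T^{(k)}|_ν`, no wrap), i.e. `□₁ ⊆ □₂` (`box_subset_of_margin`); and `2(2R₁+1) ≤ 2(2m+1) ≤ 2S ≤ |T^{(k)}|_μ`
(`two_mul_side_le_of_margin`).  Feeding (1), (2) to F10 gives (2.65) with the positional hypotheses in print's form.

WHAT THIS FILE PROVES (kernel-checked, zero `sorry`; theorems only — NO definition, NO `Prop`-valued fact; axioms standard).
 §1 **`mem_underRegion_of_tdist_le`** (coarse margin ⇒ fine depth), `sbox_lt_sitesPerDir`, `two_mul_sbox_le_sitesPerDir`,
    **`box_subset_of_margin`** (the centred cube of radius `R₁ ≤ m` lies in `□₂`), `two_mul_side_le_of_margin`.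
 §2 **`eq265_higgs_region_margins`** — (2.65) value clause on the carrier: F10's `eq265_higgs_region_from260` word for word except (located
    edits): the hypothesis `□₁ ⊆ □₂` is DROPPED (derived); the `□₁`-binders `(q₁ R₁), 2(2R₁+1) ≤ |T^{(k)}|_μ →` become `(q₁ R₁ m), R₁ ≤ m →
    2r_S + 2·half·(d+1) + 1 ≤ Lᵏm →` (the side condition is derived); the depth hypothesis on `x` («the (2r_S + 2half(d+1) + 1)-ball about
    `x` lies in `Bᵏ(□₂)`») is REPLACED by the coarse margin `∀ ν, m ≤ n_ν(x_k − q) ∧ n_ν(x_k − q) + m < S`.  The bound is F10's = F9's,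
    character for character.

HONEST SCOPE / DIFFERENCES FROM PRINT (recorded, not hidden; one sentence each).  (a) READINGS, NOT DERIVATIONS, of the radii: print's
`□₂`/`□₁` are the large blocks of `Λ₇^{(k−1)′}` within `4r(Lᵏε)`/`2r(Lᵏε)` of `y`; here `□₂ = q + [0,S)ᵈ` is a box of coarse sites in which
`ȳ` has margin `m`, `□₁` the cube of radius `R₁ ≤ m` about `ȳ` — the user reads `S ⇐ 8r(Lᵏε)/(Lᵏε) + O(1)`, `m ⇐ 4r(Lᵏε)/(Lᵏε)`,
`R₁ ⇐ 2r(Lᵏε)/(Lᵏε)` and checks `2r_S + 2half(d+1) + 1 ≤ Lᵏm` from (2.7) «r(ε) ≧ R₀|log ε|^{3r₀}» (r_S, half are `O(K₀M)`-type block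
radii of p35's cube system); `□₁ ⊆ Λ₆`, `□₂ ⊆ Λ₂`, `Bᵏ(□₂)` a cell box and `Bᵏ(Λ₂)` a big-block union STAY hypotheses (print: «Of course
□ ⊂ Bᵏ(Λ₂^{(k−1)′})», the regions (2.8)).  (b) Everything else as in F10's HONEST SCOPE (value clause only; torus sub-family; (2.60)'s size in
r14's explicit form; zero external field in (2.54); general (2.55) thresholds; base point the corner; constants' provenance — none minted
here).  NOT summit progress.
-/

open scoped BigOperators

noncomputable section

namespace Literature.MathematicalPhysics.QuantumFieldTheory.Balaban1983to89.B2Eq265BoxMargins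

open HiggsLattice (ChargeData)
open HiggsAveraging (blockIter toFinest)
open HiggsCovariance (avgQkAdj)
open B2Eq255Concrete (bgScalar256 underRegion mem_underRegion Restr255)
open B2Eq265From260 (eq265_higgs_region_from260)
open B2Eq265ConstantPart (val_sub_toFinest_eq mem_underRegion_iff_offsets)
open B2Ineq329ZeroAveraging (sitesPerDir_zero_eq)
open B2Lemma23HiggsLattice (cutMin)
open B1Eq211ZeroFieldTorus (Shape)
open B3MultiscaleFields (toSite ofSite)
open B1Ineq225RegularBox (cellBox)
open B1Ineq234Concrete (distC)
open B1TorusRegionHSizes (IsBigBlockUnion)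
open B1TorusCubeCover (half)
open B1TorusCubeLocality26 (rS)

variable {P : HiggsLattice.Params} {k : ℕ}

/-! ## §1 Coarse margins: depth of `x` in `□ = Bᵏ(□₂)` and `□₁ ⊆ □₂` -/

section Margins
/-- **COARSE MARGIN ⇒ FINE DEPTH.**  If `□₂` IS the box `q + [0,S)ᵈ` of coarse sites with `2LᵏS ≤ |T_ε|_ν`, `x_k` has offsets from `q`
in `[m, S − m)` (strictly: `m ≤ n_ν(x_k − q)`, `n_ν(x_k − q) + m < S`) and `R ≤ Lᵏm`, then every fine site `z` with `|x − z| ≤ R` ((1.3))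
lies in `□ = Bᵏ(□₂)` — print's «x ∈ Bᵏ(y)» with `y` deep inside `□₂`. [cite: Balaban1982Higgs2, Lemma 2.4 proof p.572 «Let us define □₁, □₂ as the sums of large blocks contained in Λ₇^{(k−1)′} and distant from the point y less than 2r(Lᵏε), 4r(Lᵏε) respectively, and let us denote □ = Bᵏ(□₂). Of course □ ⊂ Bᵏ(Λ₂^{(k−1)′}).»]
[cite: Balaban1982Higgs1, (1.3) p.604, (1.19)–(1.20) p.607] -/
theorem mem_underRegion_of_tdist_le (hk : k ≤ P.K) (q : HiggsLattice.Site P k) (Sbox : ℕ) (sq₂ : Finset (HiggsLattice.Site P k))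
    (hsq₂ : ∀ y : HiggsLattice.Site P k, y ∈ sq₂ ↔ ∀ ν : Fin P.d, (y ν - q ν).val < Sbox)
    (h2S : ∀ μ : Fin P.d, 2 * (P.L ^ k * Sbox) ≤ P.sitesPerDir 0 μ) (x : HiggsLattice.Site P 0) (m R : ℕ)
    (hRm : R ≤ P.L ^ k * m)
    (hmargin : ∀ ν : Fin P.d, m ≤ ((blockIter k x) ν - q ν).val ∧ ((blockIter k x) ν - q ν).val + m < Sbox)
    {z : HiggsLattice.Site P 0} (hz : HiggsLattice.Site.tdist x z ≤ R) : z ∈ underRegion k sq₂ := by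
  rw [mem_underRegion_iff_offsets hk q Sbox sq₂ hsq₂]
  intro ν
  haveI : NeZero (P.sitesPerDir 0 ν) := ⟨(P.sitesPerDir_pos 0 ν).ne'⟩
  have hLk : 0 < P.L ^ k := pow_pos P.hL k
  obtain ⟨hm1, hm2⟩ := hmargin ν
  -- the fine offset of `x` from the corner: `Lᵏm ≤ ox`, `ox + Lᵏm < LᵏS`
  have hox := val_sub_toFinest_eq hk q x ν
  have hr : (x ν).val % P.L ^ k < P.L ^ k := Nat.mod_lt _ hLk
  have hlow : P.L ^ k * m ≤ (x ν - toFinest q ν).val := by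
    rw [hox]
    exact le_trans (Nat.mul_le_mul_left _ hm1) (Nat.le_add_right _ _)
  have hup : (x ν - toFinest q ν).val + P.L ^ k * m < P.L ^ k * Sbox := by
    rw [hox]
    have h1 : P.L ^ k * (((blockIter k x) ν - q ν).val + 1 + m) ≤ P.L ^ k * Sbox := Nat.mul_le_mul_left _ (by omega)
    have h2 : P.L ^ k * (((blockIter k x) ν - q ν).val + 1 + m)
        = P.L ^ k * ((blockIter k x) ν - q ν).val + P.L ^ k + P.L ^ k * m := by ring
    omega
  -- one coordinate of `z` is within `R` of `x` in one of the two orientations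
  have hν : min (x ν - z ν).val (z ν - x ν).val ≤ R :=
    le_trans (Finset.le_sup (f := fun μ : Fin P.d => min (x μ - z μ).val (z μ - x μ).val) (Finset.mem_univ ν)) hz
  have hn : 2 * (P.L ^ k * Sbox) ≤ P.sitesPerDir 0 ν := h2S ν
  rcases min_le_iff.mp hν with h | h
  · -- `z` behind `x`: `z − q̄ = (x − q̄) − (x − z)`
    have e : z ν - toFinest q ν = (x ν - toFinest q ν) - (x ν - z ν) := by ring
    rw [e, ZMod.val_sub (by omega)]
    omega
  · -- `z` ahead of `x`: `z − q̄ = (z − x) + (x − q̄)`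
    have e : z ν - toFinest q ν = (z ν - x ν) + (x ν - toFinest q ν) := by ring
    have hlt : (z ν - x ν).val + (x ν - toFinest q ν).val < P.sitesPerDir 0 ν := by omega
    rw [e, ZMod.val_add_of_lt hlt]
    omega

/-- `LᵏS < |T_ε|_ν = Lᵏ|T^{(k)}|_ν` gives `S < |T^{(k)}|_ν`. [cite: Balaban1982Higgs1, (1.19)–(1.20) p.607] -/
theorem sbox_lt_sitesPerDir (hk : k ≤ P.K) {Sbox : ℕ} (hSbox : ∀ μ : Fin P.d, P.L ^ k * Sbox < P.sitesPerDir 0 μ) (ν : Fin P.d) :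
    Sbox < P.sitesPerDir k ν := by
  have h := hSbox ν
  rw [sitesPerDir_zero_eq hk ν] at h
  exact Nat.lt_of_mul_lt_mul_left h

/-- `2LᵏS ≤ |T_ε|_ν = Lᵏ|T^{(k)}|_ν` gives `2S ≤ |T^{(k)}|_ν`. [cite: Balaban1982Higgs1, (1.19)–(1.20) p.607] -/
theorem two_mul_sbox_le_sitesPerDir (hk : k ≤ P.K) {Sbox : ℕ} (h2S : ∀ μ : Fin P.d, 2 * (P.L ^ k * Sbox) ≤ P.sitesPerDir 0 μ)
    (ν : Fin P.d) : 2 * Sbox ≤ P.sitesPerDir k ν := by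
  have h := h2S ν
  rw [sitesPerDir_zero_eq hk ν] at h
  have hLk : 0 < P.L ^ k := pow_pos P.hL k
  have e : 2 * (P.L ^ k * Sbox) = P.L ^ k * (2 * Sbox) := by ring
  rw [e] at h
  exact Nat.le_of_mul_le_mul_left h hLk

/-- **THE CENTRED CUBE `□₁` OF RADIUS `R₁ ≤ m` ABOUT `ȳ` LIES IN `□₂`** when `ȳ` has margin `m` in the box `□₂ = q + [0,S)ᵈ`
(`S < |T^{(k)}|_ν`): print's «□₁, □₂ … distant from the point y less than 2r(Lᵏε), 4r(Lᵏε) respectively» (`2r ≤ 4r`). [cite: Balaban1982Higgs2, Lemma 2.4 proof p.572 «Let us define □₁, □₂ as the sums of large blocks contained in Λ₇^{(k−1)′} and distant from the point y less than 2r(Lᵏε), 4r(Lᵏε) respectively, and let us denote □ = Bᵏ(□₂). Of course □ ⊂ Bᵏ(Λ₂^{(k−1)′}).»] -/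
theorem box_subset_of_margin (hk : k ≤ P.K) (q : HiggsLattice.Site P k) (Sbox : ℕ) (sq₂ sq₁ : Finset (HiggsLattice.Site P k))
    (hsq₂ : ∀ y : HiggsLattice.Site P k, y ∈ sq₂ ↔ ∀ ν : Fin P.d, (y ν - q ν).val < Sbox)
    (hSbox : ∀ μ : Fin P.d, P.L ^ k * Sbox < P.sitesPerDir 0 μ)
    (q₁ ybar : HiggsLattice.Site P k) (R₁ m : ℕ) (hR₁m : R₁ ≤ m)
    (hsq₁ : ∀ y : HiggsLattice.Site P k, y ∈ sq₁ ↔ ∀ ν : Fin P.d, (y ν - q₁ ν).val < 2 * R₁ + 1)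
    (hcentre : ∀ ν : Fin P.d, (ybar ν - q₁ ν).val = R₁)
    (hmargin : ∀ ν : Fin P.d, m ≤ (ybar ν - q ν).val ∧ (ybar ν - q ν).val + m < Sbox) : sq₁ ⊆ sq₂ := by
  intro y hy
  rw [hsq₂]
  intro ν
  haveI : NeZero (P.sitesPerDir k ν) := ⟨(P.sitesPerDir_pos k ν).ne'⟩
  have hn : Sbox < P.sitesPerDir k ν := sbox_lt_sitesPerDir hk hSbox ν
  obtain ⟨hm1, hm2⟩ := hmargin ν
  have hy1 : (y ν - q₁ ν).val < 2 * R₁ + 1 := (hsq₁ y).mp hy ν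
  have hc := hcentre ν
  -- `n(q₁ − q) = n(ȳ − q) − R₁`
  have e1 : q₁ ν - q ν = (ybar ν - q ν) - (ybar ν - q₁ ν) := by ring
  have hq₁ : (q₁ ν - q ν).val = (ybar ν - q ν).val - R₁ := by
    rw [e1, ZMod.val_sub (by rw [hc]; omega), hc]
  -- `n(y − q) = n(y − q₁) + n(q₁ − q) < Sbox`
  have e2 : y ν - q ν = (y ν - q₁ ν) + (q₁ ν - q ν) := by ring
  have hlt : (y ν - q₁ ν).val + (q₁ ν - q ν).val < P.sitesPerDir k ν := by rw [hq₁]; omega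
  rw [e2, ZMod.val_add_of_lt hlt, hq₁]
  omega

/-- the side `2R₁ + 1 ≤ 2m + 1 ≤ S` of `□₁` is at most half the torus: `2(2R₁+1) ≤ 2S ≤ |T^{(k)}|_μ`. [cite: Balaban1982Higgs2, Lemma 2.4 proof p.572 «Let us define □₁, □₂ as the sums of large blocks contained in Λ₇^{(k−1)′} and distant from the point y less than 2r(Lᵏε), 4r(Lᵏε) respectively, and let us denote □ = Bᵏ(□₂). Of course □ ⊂ Bᵏ(Λ₂^{(k−1)′}).»] -/
theorem two_mul_side_le_of_margin (hk : k ≤ P.K) {Sbox : ℕ} (h2S : ∀ μ : Fin P.d, 2 * (P.L ^ k * Sbox) ≤ P.sitesPerDir 0 μ)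
    (q ybar : HiggsLattice.Site P k) (R₁ m : ℕ) (hR₁m : R₁ ≤ m)
    (hmargin : ∀ ν : Fin P.d, m ≤ (ybar ν - q ν).val ∧ (ybar ν - q ν).val + m < Sbox) (μ : Fin P.d) :
    2 * (2 * R₁ + 1) ≤ P.sitesPerDir k μ := by
  have h := two_mul_sbox_le_sitesPerDir hk h2S μ
  obtain ⟨hm1, hm2⟩ := hmargin μ
  omega

end Margins

/-! ## §2 (2.65) with the positional hypotheses in print's form -/

section Eq265Margins

/-- **LEMMA 2.4 (2.65), VALUE CLAUSE, ON THE (Higgs)₂,₃ CARRIER — «x ∈ Bᵏ(y)», `y` with margin `m` in `□₂`, `□₁` the cube of radius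
`R₁ ≤ m` about `y`.**  TYPED vs PRINTED: this is F10's `B2Eq265From260.eq265_higgs_region_from260` word for word except the located edits:
`□₁ ⊆ □₂` is no longer a hypothesis (`box_subset_of_margin`); the `□₁`-binders read `(q₁ R₁ m), R₁ ≤ m → 2r_S + 2·half·(d+1) + 1 ≤ Lᵏm →
(∀ y, y ∈ □₁ ↔ n_ν(y − q₁) < 2R₁+1) →` (`2(2R₁+1) ≤ |T^{(k)}|_μ` derived, `two_mul_side_le_of_margin`); the depth hypothesis on `x` is
REPLACED by the margin `∀ ν, m ≤ n_ν(x_k − q) ∧ n_ν(x_k − q) + m < S` (`mem_underRegion_of_tdist_le`); `n_ν(x_k − q₁) = R₁` kept.  The bound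
is F10's, character for character. [cite: Balaban1982Higgs2, Lemma 2.4 (2.65) p.572]
[cite: Balaban1982Higgs2, Lemma 2.4 proof p.572 «Let us define □₁, □₂ as the sums of large blocks contained in Λ₇^{(k−1)′} and distant from the point y less than 2r(Lᵏε), 4r(Lᵏε) respectively, and let us denote □ = Bᵏ(□₂). Of course □ ⊂ Bᵏ(Λ₂^{(k−1)′}).»] -/
theorem eq265_higgs_region_margins (d L : ℕ) (hd : 1 ≤ d) (hL : Odd L ∧ 1 < L) {a : ℝ} (ha : 0 < a) {msq : ℝ} (hmsq : 0 < msq)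
    {aV : ℝ} (haV : 0 < aV) {mu0sq : ℝ} (hmu0 : 0 < mu0sq)
    (N : ℕ) (C : ChargeData N) (ε₀ : ℝ) (creg β : ℝ) (hcreg : 0 ≤ creg) (hβ : 0 < β) :
    ∃ δ CV CF : ℝ, 0 < δ ∧ 0 < CV ∧ 0 < CF ∧
    ∃ K₀min : ℕ, ∀ K₀ : ℕ, K₀min ≤ K₀ → ∃ e₁ t : ℝ, 0 < e₁ ∧ 0 < t ∧
      ∃ C₁ C₂ C₃ D₁ D₂ D₃ D₄ : ℝ, 0 ≤ C₁ ∧ 0 ≤ C₂ ∧ 0 ≤ C₃ ∧ 0 ≤ D₁ ∧ 0 ≤ D₂ ∧ 0 ≤ D₃ ∧ 0 ≤ D₄ ∧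
      ∀ (P : HiggsLattice.Params) (_ : Shape P), P.d = d → P.L = L → K₀ ∣ P.M →
      ∀ {k : ℕ}, 1 ≤ k → k ≤ P.K → (∀ μ, 3 * half P k K₀ ≤ P.sitesPerDir 0 μ) → P.mesh k ≤ ε₀ → P.mesh k ≤ 1 →
      ∀ (Λ₂ Λ₆ sq₂ sq₁ : Finset (HiggsLattice.Site P k)) (S : Fin P.d → Finset ℕ) (q : HiggsLattice.Site P k) (Sbox : ℕ),
        Λ₆ ⊆ Λ₂ → sq₂ ⊆ Λ₂ → sq₁ ⊆ Λ₆ →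
        IsBigBlockUnion k K₀ (underRegion k Λ₂) → underRegion k sq₂ = cellBox k K₀ S →
        (∀ μ : Fin P.d, P.L ^ k * Sbox < P.sitesPerDir 0 μ) →
      -- `□₂` IS the box `q + [0,S)ᵈ` of coarse sites, `□ = B^k(□₂)` smaller than half the torus
        (∀ y : HiggsLattice.Site P k, y ∈ sq₂ ↔ ∀ ν : Fin P.d, (y ν - q ν).val < Sbox) →
        (∀ μ : Fin P.d, 2 * (P.L ^ k * Sbox) ≤ P.sitesPerDir 0 μ) →
      -- `□₁` is the box of coarse sites of radius `R₁` (corner `q₁`); `m ≥ R₁` a coarse margin with `Lᵏm ≥` the depth radius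
      ∀ (q₁ : HiggsLattice.Site P k) (R₁ m : ℕ), R₁ ≤ m → 2 * rS P k K₀ + 2 * half P k K₀ * (P.d + 1) + 1 ≤ P.L ^ k * m →
        (∀ y : HiggsLattice.Site P k, y ∈ sq₁ ↔ ∀ ν : Fin P.d, (y ν - q₁ ν).val < 2 * R₁ + 1) →
      -- LEMMA 2.3's DATA: the region `Λ₋₁ ⊇ Λ₂` of (2.55), the cutoff `ζ^{(k)}` of (2.44), the step's vector field `A′` with (2.55)₁,₂ integrated
      ∀ (Λm1 : Finset (HiggsLattice.Site P k)), Λ₂ ⊆ Λm1 →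
      ∀ (ζ : HiggsLattice.Site P 0 → HiggsLattice.Site P k → ℝ) (ρ ρ₁ : ℝ), 0 ≤ ρ₁ →
        (∀ x y', |ζ x y'| ≤ 1) →
        (∀ x y', ζ x y' ≠ 0 → (HiggsLattice.Site.tdist (blockIter k x) y' : ℝ) ≤ ρ) →
        (∀ x y', (HiggsLattice.Site.tdist (blockIter k x) y' : ℝ) ≤ ρ₁ → ζ x y' = 1) →
        (∀ (x : HiggsLattice.Site P 0) (ν : Fin P.d) (y' : HiggsLattice.Site P k), |ζ (x.shift ν) y' - ζ x y'| ≤ ((P.L : ℝ) ^ k)⁻¹) →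
        (∀ x y', blockIter k x ∈ Λ₂ → (HiggsLattice.Site.tdist (blockIter k x) y' : ℝ) ≤ ρ + 1 → y' ∈ Λm1) →
      ∀ (C₀ : ChargeData P.d) (A' : HiggsLattice.VecField P k) (tV qV r₁ r₂ : ℝ), 0 ≤ tV → 0 ≤ qV → 0 ≤ r₁ → 0 ≤ r₂ →
        (∀ y' ∈ Λm1, ‖toSite A' y'‖ ≤ tV) →
        (∀ y ∈ Λ₂, ∀ y' ∈ Λm1, ‖toSite A' y' - toSite A' y‖ ≤ qV * (r₁ + r₂ * (HiggsLattice.Site.tdist y y' : ℝ))) →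
      -- `δA` is at least the (2.60) bound, and small in the two printed scalings
      ∀ {δA : ℝ}, ((P.L : ℝ) ^ k)⁻¹ * (CV * (r₁ + r₂) * qV + CF * Real.exp (-(δ * ρ₁)) * tV) ≤ δA →
          (P.L : ℝ) ^ k * δA * |C.e| ≤ t →
        ∀ {ec : ℝ}, 0 < ec → ec ≤ e₁ → (P.L : ℝ) ^ k * P.mesh k * |C.e| * δA ≤ creg * ec ^ β →
      -- `x ∈ Bᵏ(ȳ)` with `ȳ` the centre of `□₁` and at least `m` inside `□₂` in every direction
      ∀ (x : HiggsLattice.Site P 0),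
        (∀ ν : Fin P.d, m ≤ ((blockIter k x) ν - q ν).val ∧ ((blockIter k x) ν - q ν).val + m < Sbox) →
        (∀ ν : Fin P.d, ((blockIter k x) ν - q₁ ν).val = R₁) →
      -- the restrictions (2.55) on `Λ₋₁` for the fields `A′, φ` of the step and the background `A^{(k)} = a_kζ^{(k)}G_kQ_k^*A′`
      ∀ (φ : HiggsLattice.ScalarField P k N) {c₁ pℓ tA tPhi : ℝ}, 0 ≤ c₁ → 0 ≤ pℓ → 0 ≤ tPhi →
        Restr255 C c₁ pℓ tA tPhi k Λm1 A' φ (ofSite (cutMin C₀ mu0sq aV k ζ (toSite A'))) →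
        ‖bgScalar256 C msq a k Λ₂ Λ₆ (ofSite (cutMin C₀ mu0sq aV k ζ (toSite A'))) φ x
            - avgQkAdj C (ofSite (cutMin C₀ mu0sq aV k ζ (toSite A'))) k φ x‖
          ≤ B1.aSeq a P.L k * (c₁ * tPhi * pℓ) *
                (C₁ * Real.exp (-(1 / (4 * K₀) * (distC (underRegion k sq₂) x / (P.L : ℝ) ^ k)))
                  + C₂ * Real.exp (-(1 / (4 * K₀) * ((R₁ : ℝ) + 1))))
            + (D₁ * P.mesh k ^ 2 *
                (B1.aSeq a P.L k * (P.mesh k)⁻¹ ^ 2 * (|C.e| * (δA * (P.d * ((P.L : ℝ) ^ k * Sbox))) * P.mesh 0 * (P.d * ((P.L : ℝ) ^ k - 1))) * (c₁ * tPhi * pℓ)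
                  + |C.e| * (δA * (P.d * ((P.L : ℝ) ^ k * Sbox))) * (P.d * ((B1.aSeq a P.L k * (P.mesh k)⁻¹ ^ 2 * (c₁ * tPhi * pℓ) * D₄ * P.mesh k
                        + |C.e| * (δA * (P.d * ((P.L : ℝ) ^ k * Sbox))) * (B1.aSeq a P.L k * D₃ * (c₁ * tPhi * pℓ))) + |C.e| * (δA * (P.d * ((P.L : ℝ) ^ k * Sbox))) * (B1.aSeq a P.L k * D₃ * (c₁ * tPhi * pℓ))))
                  + B1.aSeq a P.L k * (P.mesh k)⁻¹ ^ 2 *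
                      ((2 * (|C.e| * (δA * (P.d * ((P.L : ℝ) ^ k * Sbox))) * P.mesh 0 * (P.d * ((P.L : ℝ) ^ k - 1)))
                        + (|C.e| * (δA * (P.d * ((P.L : ℝ) ^ k * Sbox))) * P.mesh 0 * (P.d * ((P.L : ℝ) ^ k - 1))) ^ 2) * (B1.aSeq a P.L k * D₃ * (c₁ * tPhi * pℓ))))
              + D₂ * P.mesh k * (|C.e| * (δA * (P.d * ((P.L : ℝ) ^ k * Sbox))) * (B1.aSeq a P.L k * D₃ * (c₁ * tPhi * pℓ))))
            + B1.aSeq a P.L k * C₃ *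
                (4 * K₀ * ((P.mesh k * (c₁ * pℓ) + P.mesh k * |C.e| * (δA * (P.d * ((P.L : ℝ) ^ k * Sbox))) * (c₁ * tPhi * pℓ)) * P.d)
                  + Real.exp (-(1 / (4 * K₀) * ((R₁ : ℝ) + 1))) * (c₁ * tPhi * pℓ))
            + msq * P.mesh k ^ 2 / (B1.aSeq a P.L k + msq * P.mesh k ^ 2) * (c₁ * tPhi * pℓ)
            + |C.e| * P.mesh 0 * (P.d * ((P.L : ℝ) ^ k - 1)) * (δA * (P.d * ((P.L : ℝ) ^ k * Sbox))) * (c₁ * tPhi * pℓ) := by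
  obtain ⟨δ, CV, CF, hδ, hCV, hCF, K₀min, h⟩ := eq265_higgs_region_from260 d L hd hL ha hmsq haV hmu0 N C ε₀ creg β hcreg hβ
  refine ⟨δ, CV, CF, hδ, hCV, hCF, K₀min, fun K₀ hK₀ => ?_⟩
  obtain ⟨e₁, t, he₁, ht, C₁, C₂, C₃, D₁, D₂, D₃, D₄, hC₁, hC₂, hC₃, hD₁, hD₂, hD₃, hD₄, h⟩ := h K₀ hK₀
  refine ⟨e₁, t, he₁, ht, C₁, C₂, C₃, D₁, D₂, D₃, D₄, hC₁, hC₂, hC₃, hD₁, hD₂, hD₃, hD₄, ?_⟩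
  intro P S hPd hPL hK₀M k hk1 hkK h3 hε h1 Λ₂ Λ₆ sq₂ sq₁ Sfin q Sbox h62 hs2 h16 hΩΛ hbox hSbox hsq₂ h2S q₁ R₁ m hR₁m hRm hsq₁
    Λm1 h2m1 ζ ρ ρ₁ hρ₁ zeta_abs zeta_supp zeta_one zeta_lip nbhd C₀ A' tV qV r₁ r₂ htV hqV hr₁ hr₂ hA_abs hA_var δA h60δ ht' ec hec
    hle hsmall x hmargin hcentre φ c₁ pℓ tA tPhi hc₁ hpℓ htPhi h255
  -- the three geometric hypotheses of F10, from the margin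
  have h12 : sq₁ ⊆ sq₂ := box_subset_of_margin hkK q Sbox sq₂ sq₁ hsq₂ hSbox q₁ (blockIter k x) R₁ m hR₁m hsq₁ hcentre hmargin
  have hS₁ : ∀ μ : Fin P.d, 2 * (2 * R₁ + 1) ≤ P.sitesPerDir k μ :=
    two_mul_side_le_of_margin hkK h2S q (blockIter k x) R₁ m hR₁m hmargin
  have hx : ∀ z, HiggsLattice.Site.tdist x z ≤ 2 * rS P k K₀ + 2 * half P k K₀ * (P.d + 1) + 1 → z ∈ underRegion k sq₂ :=
    fun z hz => mem_underRegion_of_tdist_le hkK q Sbox sq₂ hsq₂ h2S x m _ hRm hmargin hz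
  exact h P S hPd hPL hK₀M hk1 hkK h3 hε h1 Λ₂ Λ₆ sq₂ sq₁ Sfin q Sbox h62 hs2 h12 h16 hΩΛ hbox hSbox hsq₂ h2S q₁ R₁ hS₁ hsq₁ Λm1 h2m1
    ζ ρ ρ₁ hρ₁ zeta_abs zeta_supp zeta_one zeta_lip nbhd C₀ A' tV qV r₁ r₂ htV hqV hr₁ hr₂ hA_abs hA_var h60δ ht' hec hle hsmall x hx
    hcentre φ hc₁ hpℓ htPhi h255

end Eq265Margins

end Literature.MathematicalPhysics.QuantumFieldTheory.Balaban1983to89.B2Eq265BoxMargins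

end
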